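/-
Copyright: pub-balaban β-flow team, BINDER row D4 OWNER (unit `b2b-balaban-beta-an4`).  ROW-D4 JUNCTION, leaf 3: the NECESSITY side of the
run-level binders the row's consumers carry on the as-printed carrier of [I] (prover 1's `hrg`, the box-wide (U)), certified by ONE def-free
toy setting of `Balaban1983to89.B12BetaAsPrinted`.  NOTHING of [I] is asserted; no toy resembles Bałaban's objects; (D4) is NOT discharged.
-/
import Summits.QuantumFields.BalabanUV.Beta.EriceFlowEnclosureB12AsPrintedTunedWitness

/-!
# Row-D4 junction, leaf 3 — what the as-printed interface + Theorem 2 do NOT supply: (0.20) along in-interval runs, and (U) on the boxes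

The row-D4 junction `B12AsPrintedRowD4Junction` records what the statement-exact typing of [Balaban1987RG1] (`B12BetaAsPrinted`) supplies
BY NAME — in particular the (U)-letter |β_{j+1}(g₀, …, g_j)| ≦ β′₅₁₀ ON RUN PREFIXES OF THEOREM-3 RUNS ONLY (`abs_beta_prefix_le_betaPrime510`,
observation O-2).  Its consumers `EriceFlowEnclosureB12AsPrintedTuned` ∕ `…TunedUpper` (prover 1) and `…Lower` (prover 2) read that letter
along Theorem 2's tuned runs, which are runs Theorem 3 speaks of only GIVEN prover 1's located binder
`hrg : ∀ P, Step.InInterval S.γ P.K (S.cpl P) → FlowStep.RGEqH P.K S.β (S.cpl P)` — discharged in the tree from the box-wide (U)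
(`…TunedUpper.hrg_of_betaUpperH`) or from the halting normalisation (`…LowerEnd.hrg_of_halts`), and shown satisfiable
(`…TunedWitness.tunedHypotheses_nonvacuous`).  THIS LEAF SUPPLIES THE MISSING HALF, kernel-checked: `hrg` — and with it the box-wide (U) and
the halting clause — is NOT a consequence of `StandingHypotheses ∧ Definitions ∧ Conclusions ∧ Theorem2Statement`, not even together with the
sub-cell's other two box letters (L) `BetaLowerH` and (C) `BetaContH`.  The reason is the quantifier shape O-2 itself: every run-level field
of `Conclusions` has Theorem 3's run hypothesis `RunHyp S P` (which CONTAINS (0.20) along the run) as antecedent, and (0.20) is typed in its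
forward-determination form `Definitions.d020` (silent where the right side is not positive; DELTA-I D-4): a setting in which (0.20) never has
a positive solution satisfies every printed field vacuously beyond K = 0, whatever its coupling table does — and the table may still obey
Theorem 2's (0.31) to the letter.

THE OVERRUN TOY ([folklore] objects of ours, built INSIDE an existence proof — def-free): L = 13, γ = 1; β_{k+1}(g₀, …, g_k) := 1∕g_k² (the
right side of (0.20) vanishes identically); kernels Π_{k+1} := (1∕g_k²)·Re Qᵀ, pol F := F(1)·Re Qᵀ, log Z ≡ 0, 𝐄_int = 𝐄 := 1∕g_k² (prover 1's
toy kernel `…Witness.secondMoment_toyKernel ∕ fourier_toyKernel ∕ reflect_toyKernel ∕ decay510_toyKernel` BY NAME); the coupling table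
IGNORES β and runs on: g₀ at k = 0, `(1∕g₀² − k)^{−1∕2}` at k ≥ 1, so from g₀ := (1∕g² + K)^{−1∕2}: `1∕g_k² = 1∕g² + (K − k)` EXACTLY.

WHAT THIS FILE PROVES (0 sorry, 0 def): §1 the toy's letters from its defining equations — `rhs020_eq_zero`, **`runHyp_K_eq_zero`** (no run
Theorem 3 speaks of takes a step), `no_step`, **`not_betaUpperH`**, `betaLowerH_of_toy`, `betaContH_of_toy`, `cpl_tuned` ∕ `tuned_run` ∕
`tuned_le` ∕ `tuned_end`, **`theorem2Statement_of_toy`**, `run_one_of_toy`, **`not_hrg_of_toy`**, **`not_halts_of_toy`**; §2 **`overrunToy_exists`**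
(`StandingHypotheses ∧ Definitions ∧ Conclusions`, defining equations exported); §3 HEADLINES **`asPrinted_and_theorem2_consistent_with_not_hrg`**,
**`hrg_independent_of_asPrinted_and_theorem2`** (the other direction by prover 1's `tunedHypotheses_nonvacuous`),
**`boxUpperH_independent_of_asPrinted_and_theorem2`** (O-2 two-sided, with prover 1's AF toy), **`letters_of_overrunToy`** ((L) and (C) hold,
(U) and `hrg` fail: among the three box letters it is (U) that carries `hrg`), **`no_thm3_run_at_K_one`** and
**`thm3Runs_independent_of_asPrinted_and_theorem2`** (B16 p. 355's sentence «Theorem 2 of [I] allows us to remove the assumption» is NOT a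
consequence of the typed interface + Theorem 2: `…Tuned.runHyp_of_theorem2Statement` ∕ `conclusions_along_tuned` ∕
`theorem2_rate_le_betaPrime510` and `…Lower.theorem2Statement_forces_af_steps` genuinely need `hrg` or a letter implying it).

ROW IMPACT (BINDER-OWNERS row D4): class NONE — certification over the interface; instance 0∕1; (D4) NOT discharged; NOT Theorem 2, NOT
BetaPertH, NOT continuum, NOT Clay.  HONEST DEPENDENCY: continuum YM on T⁴ ⇐ BetaPertH ∧ nine spine estimates (0∕9 proved); BetaPertH ⇐
(D1) ∧ (D4) ∧ CAP+tail.

statement-level skeleton of published theorems with citation tags; proofs where landed; nothing here is a claim about the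
Yang–Mills mass gap
-/

noncomputable section

namespace Summit.QuantumFields.BalabanUV.Beta.B12AsPrintedRowD4JunctionHrgWitness

open Literature.MathematicalPhysics.QuantumFieldTheory.Balaban1983to89
open Literature.MathematicalPhysics.QuantumFieldTheory.Balaban1983to89.B12BetaAsPrinted
open Literature.MathematicalPhysics.QuantumFieldTheory.Balaban1983to89.B12Rep537 (wilsonQ MQ MQ_nonneg)
open Literature.MathematicalPhysics.QuantumFieldTheory.Balaban1983to89.FlowStep (prefixOf prefixOf_apply Box BetaUpperH BetaLowerH
  BetaContH mem_box)
open Summit.QuantumFields.BalabanUV.Beta.EriceFlowEnclosureB12AsPrintedMarginal (wilsonQ_perm wilsonQ_neg_transpose)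
open Summit.QuantumFields.BalabanUV.Beta.EriceFlowEnclosureB12AsPrintedWitness (secondMoment_toyKernel decay510_toyKernel
  fourier_toyKernel reflect_toyKernel asPrinted_consistent_with_theorem2_and_AF)
open Summit.QuantumFields.BalabanUV.Beta.EriceFlowEnclosureB12AsPrintedTunedWitness (tunedHypotheses_nonvacuous)

variable {S : Setting}

/-! ## §1 The overrun toy's letters, from its defining equations -/

/-- With β_{k+1}(g₀, …, g_k) = 1∕g_k² the right side of (0.20) VANISHES at every run prefix — (0.20) has no positive solution anywhere, so
the printed forward determination `Definitions.d020` never fires. [cite: Balaban1987RG1, (0.20) p.256] -/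
theorem rhs020_eq_zero (hβ : ∀ (k : ℕ) (p : Fin (k + 1) → ℝ), S.β k p = 1 / (p (Fin.last k)) ^ 2) (g : ℕ → ℝ) (k : ℕ) :
    1 / (g k) ^ 2 - S.β k (prefixOf g k) = 0 := by
  rw [hβ, prefixOf_apply, Fin.val_last, sub_self]

/-- **NO RUN THEOREM 3 SPEAKS OF TAKES A STEP.**  If β_{k+1}(g₀, …, g_k) = 1∕g_k², `RunHyp S P` ((0.20) along the run, «0 < g_k ≦ γ,
k ≦ K») forces K = 0 (at k = 0 the recursion would read 1∕g₁² = 0): every run-level field of `Conclusions` («∀ j, j + 1 ≦ K → …») is then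
VACUOUS, whatever the coupling table. [cite: Balaban1987RG1, Thm 3 p.264 with (0.20) p.256] -/
theorem runHyp_K_eq_zero {P : B12.RunParams} (hP : RunHyp S P)
    (hβ : ∀ (k : ℕ) (p : Fin (k + 1) → ℝ), S.β k p = 1 / (p (Fin.last k)) ^ 2) : P.K = 0 := by
  by_contra hK
  have hk : 0 < P.K := Nat.pos_of_ne_zero hK
  have hrg := hP.rg 0 hk
  have h0 := rhs020_eq_zero hβ (S.cpl P) 0
  have h1 : 0 < 1 / (S.cpl P (0 + 1)) ^ 2 := by have := (hP.inInterval (0 + 1) (Nat.succ_le_of_lt hk)).1; positivity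
  linarith

/-- … so under `RunHyp S P` no step «j + 1 ≦ K» exists. [cite: Balaban1987RG1, Thm 3 p.264] -/
theorem no_step {P : B12.RunParams} (hP : RunHyp S P) {j : ℕ} (hj : j + 1 ≤ P.K)
    (hβ : ∀ (k : ℕ) (p : Fin (k + 1) → ℝ), S.β k p = 1 / (p (Fin.last k)) ^ 2) : False := by
  have h := runHyp_K_eq_zero hP hβ
  omega

/-- **THE BOX-WIDE UPPER LETTER (U) FAILS** for every b′ and every γ > 0: the one-point history t = min(γ, 1∕(|b′| + 2)) ∈ ]0, γ] has
β₁(t) = 1∕t² ≧ (|b′| + 2)² > b′.  (The interface's (U) lives on run prefixes of Theorem-3 runs only — O-2.) [cite: Balaban1987RG1, p.264 («uniformly bounded») with Thm 3 p.264] -/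
theorem not_betaUpperH (hβ : ∀ (k : ℕ) (p : Fin (k + 1) → ℝ), S.β k p = 1 / (p (Fin.last k)) ^ 2) (b' : ℝ) {γ : ℝ}
    (hγ : 0 < γ) : ¬ BetaUpperH b' γ S.β := by
  intro hU
  have hB : 0 < |b'| + 2 := by positivity
  obtain ⟨t, htpos, htγ, htb⟩ : ∃ t : ℝ, 0 < t ∧ t ≤ γ ∧ t ≤ 1 / (|b'| + 2) :=
    ⟨min γ (1 / (|b'| + 2)), lt_min hγ (by positivity), min_le_left _ _, min_le_right _ _⟩
  have hmem : (fun _ : Fin (0 + 1) => t) ∈ Box γ 0 := mem_box.mpr fun _ => ⟨htpos, htγ⟩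
  have h : S.β 0 (fun _ : Fin (0 + 1) => t) ≤ b' := hU 0 _ hmem
  rw [hβ] at h
  have h1 : |b'| + 2 ≤ 1 / t := by
    rw [le_div_iff₀ htpos, ← mul_one_div_cancel hB.ne']
    exact mul_le_mul_of_nonneg_left htb hB.le
  have h2 : (|b'| + 2) ^ 2 ≤ 1 / t ^ 2 := by rw [← one_div_pow]; exact pow_le_pow_left₀ hB.le h1 2
  have h3 : |b'| + 2 ≤ (|b'| + 2) ^ 2 := by nlinarith [abs_nonneg b']
  linarith [le_abs_self b']

/-- … while the LOWER ∕ SIGN letter holds on the unit boxes: β_{k+1}(g₀, …, g_k) = 1∕g_k² ≧ 1 for g_k ∈ ]0, 1], i.e.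
`FlowStep.BetaLowerH 1 1 S.β` (asymptotic freedom in the letter's sense, with b = 1). [folklore] -/
theorem betaLowerH_of_toy (hβ : ∀ (k : ℕ) (p : Fin (k + 1) → ℝ), S.β k p = 1 / (p (Fin.last k)) ^ 2) :
    BetaLowerH 1 1 S.β := by
  intro k v hv
  rw [hβ]
  obtain ⟨h0, h1⟩ := (mem_box.mp hv) (Fin.last k)
  rw [le_div_iff₀ (by positivity), one_mul]
  calc v (Fin.last k) ^ 2 ≤ 1 ^ 2 := pow_le_pow_left₀ h0.le h1 2
    _ = 1 := one_pow 2

/-- … and the JOINT-CONTINUITY letter holds on every box: p ↦ 1∕(p_last)² is continuous where p_last ≠ 0, so `FlowStep.BetaContH γ S.β`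
for every γ. [folklore] -/
theorem betaContH_of_toy (hβ : ∀ (k : ℕ) (p : Fin (k + 1) → ℝ), S.β k p = 1 / (p (Fin.last k)) ^ 2) (γ : ℝ) :
    BetaContH γ S.β := by
  intro k
  have e : S.β k = fun p : Fin (k + 1) → ℝ => 1 / (p (Fin.last k)) ^ 2 := funext (hβ k)
  rw [e]
  refine ContinuousOn.div continuousOn_const (((continuous_apply (Fin.last k)).pow 2).continuousOn) ?_
  intro p hp
  exact pow_ne_zero 2 ((mem_box.mp hp) (Fin.last k)).1.ne'

/-- **The overrun toy's coupling table along a tuned bare coupling.**  If `cpl P k = g₀` at k = 0 and `(1∕g₀² − k)^{−1∕2}` at k ≧ 1 (a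
table that runs on whatever β says), then from g₀ := (1∕g² + K)^{−1∕2}: `g_k = (1∕g² + K − k)^{−1∕2}` for every k. [folklore] -/
theorem cpl_tuned
    (hcpl : ∀ (P : B12.RunParams) (k : ℕ), S.cpl P k = if k = 0 then P.g0 else 1 / Real.sqrt (1 / P.g0 ^ 2 - k))
    {g : ℝ} (hg : 0 < g) (K m k : ℕ) :
    S.cpl ⟨K, m, 1 / Real.sqrt (1 / g ^ 2 + K)⟩ k = 1 / Real.sqrt (1 / g ^ 2 + K - k) := by
  have hA : 0 ≤ 1 / g ^ 2 + K := by positivity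
  have e : 1 / (1 / Real.sqrt (1 / g ^ 2 + (K : ℝ))) ^ 2 = 1 / g ^ 2 + K := by
    rw [div_pow, one_pow, Real.sq_sqrt hA, one_div_one_div]
  rw [hcpl]
  rcases Nat.eq_zero_or_pos k with rfl | hk
  · simp
  · rw [if_neg hk.ne']
    show 1 / Real.sqrt (1 / (1 / Real.sqrt (1 / g ^ 2 + (K : ℝ))) ^ 2 - k) = 1 / Real.sqrt (1 / g ^ 2 + K - k)
    rw [e]

/-- Along that table, for k ≦ K: `0 < g_k` and **`1∕g_k² = 1∕g² + (K − k)` EXACTLY** — (0.31) with equal constants. [cite: Balaban1987RG1, Thm 2 (0.31) p.259] -/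
theorem tuned_run
    (hcpl : ∀ (P : B12.RunParams) (k : ℕ), S.cpl P k = if k = 0 then P.g0 else 1 / Real.sqrt (1 / P.g0 ^ 2 - k))
    {g : ℝ} (hg : 0 < g) (K m : ℕ) {k : ℕ} (hk : k ≤ K) :
    0 < S.cpl ⟨K, m, 1 / Real.sqrt (1 / g ^ 2 + K)⟩ k ∧
      1 / (S.cpl ⟨K, m, 1 / Real.sqrt (1 / g ^ 2 + K)⟩ k) ^ 2 = 1 / g ^ 2 + ((K : ℝ) - k) := by
  rw [cpl_tuned hcpl hg]
  have hB : 0 < 1 / g ^ 2 + K - k := by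
    have h1 : (k : ℝ) ≤ K := by exact_mod_cast hk
    linarith [show (0 : ℝ) < 1 / g ^ 2 by positivity]
  refine ⟨one_div_pos.mpr (Real.sqrt_pos.mpr hB), ?_⟩
  rw [div_pow, one_pow, Real.sq_sqrt hB.le, one_div_one_div]
  ring

/-- … all its couplings lie BELOW THE RENORMALIZED ONE: `g_k ≦ g` for k ≦ K (so a table ending at g ≦ γ lies in ]0, γ] — the interval
clause of Theorem 2 carried by (0.31), as prover 2's `…Lower.le_final_of_discrete031_lower` has it in general). [cite: Balaban1987RG1, Thm 2 p.259 («contained in the interval ]0, γ]»)] -/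
theorem tuned_le
    (hcpl : ∀ (P : B12.RunParams) (k : ℕ), S.cpl P k = if k = 0 then P.g0 else 1 / Real.sqrt (1 / P.g0 ^ 2 - k))
    {g : ℝ} (hg : 0 < g) (K m : ℕ) {k : ℕ} (hk : k ≤ K) : S.cpl ⟨K, m, 1 / Real.sqrt (1 / g ^ 2 + K)⟩ k ≤ g := by
  rw [cpl_tuned hcpl hg]
  have h1 : (k : ℝ) ≤ K := by exact_mod_cast hk
  have hg' : 0 < 1 / g := one_div_pos.mpr hg
  have hB : (1 / g) ^ 2 ≤ 1 / g ^ 2 + K - k := by rw [one_div_pow]; linarith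
  have h2 : 1 / g ≤ Real.sqrt (1 / g ^ 2 + K - k) :=
    calc 1 / g = Real.sqrt ((1 / g) ^ 2) := (Real.sqrt_sq hg'.le).symm
      _ ≤ Real.sqrt (1 / g ^ 2 + K - k) := Real.sqrt_le_sqrt hB
  calc 1 / Real.sqrt (1 / g ^ 2 + K - k) ≤ 1 / (1 / g) := one_div_le_one_div_of_le hg' h2
    _ = g := one_div_one_div g

/-- … and the table ENDS AT THE RENORMALIZED COUPLING: `g_K = g`. [cite: Balaban1987RG1, Thm 2 p.259 («g_K = g»)] -/
theorem tuned_end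
    (hcpl : ∀ (P : B12.RunParams) (k : ℕ), S.cpl P k = if k = 0 then P.g0 else 1 / Real.sqrt (1 / P.g0 ^ 2 - k))
    {g : ℝ} (hg : 0 < g) (K m : ℕ) : S.cpl ⟨K, m, 1 / Real.sqrt (1 / g ^ 2 + K)⟩ K = g := by
  rw [cpl_tuned hcpl hg, add_sub_cancel_right, ← one_div_pow, Real.sqrt_sq (by positivity), one_div_one_div]

/-- **THEOREM 2 AS PRINTED HOLDS FOR THE OVERRUN TOY** (L = 13; γ₀ := 1, g₁ := γ, β = β′ := 1∕ln 13, g₀ := (1∕g² + K)^{−1∕2}: a table in ]0, γ]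
ending at g_K = g with (0.31) per step as an EQUALITY).  Theorem 2 reads the coupling table only. [cite: Balaban1987RG1, Thm 2 (0.31) p.259] -/
theorem theorem2Statement_of_toy
    (hcpl : ∀ (P : B12.RunParams) (k : ℕ), S.cpl P k = if k = 0 then P.g0 else 1 / Real.sqrt (1 / P.g0 ^ 2 - k))
    (hL : S.L = 13) {hL' : Odd S.L ∧ 1 < S.L} : Theorem2Statement S hL' := by
  intro m
  have hlog : 0 < Real.log (S.L : ℝ) := by rw [hL]; exact Real.log_pos (by norm_num)
  refine ⟨1, one_pos, fun γ hγ _ => ⟨γ, hγ, fun g hg hgγ =>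
    ⟨1 / Real.log S.L, 1 / Real.log S.L, by positivity, le_rfl, fun K => ?_⟩⟩⟩
  have hI : Step.InInterval γ K (S.cpl ⟨K, m, 1 / Real.sqrt (1 / g ^ 2 + K)⟩) := fun k hk =>
    ⟨(tuned_run hcpl hg K m hk).1, (tuned_le hcpl hg K m hk).trans hgγ⟩
  have hD : Step.Discrete031 (1 / Real.log S.L * Real.log S.L) (1 / Real.log S.L * Real.log S.L) K g
      (S.cpl ⟨K, m, 1 / Real.sqrt (1 / g ^ 2 + K)⟩) := fun k hk => by
    rw [(tuned_run hcpl hg K m hk).2, one_div_mul_cancel hlog.ne', one_mul]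
    exact ⟨le_rfl, le_rfl⟩
  refine ⟨1 / Real.sqrt (1 / g ^ 2 + K), hI, tuned_end hcpl hg K m, ?_⟩
  rw [Step.logRunning_iff_discrete031]
  exact hD

/-- The overrun toy's table at (K, m, g₀) = (1, 0, 1∕2): g₀ = 1∕2, g₁ = (4 − 1)^{−1∕2} = 1∕√3, both in ]0, 1]. [folklore] -/
theorem run_one_of_toy
    (hcpl : ∀ (P : B12.RunParams) (k : ℕ), S.cpl P k = if k = 0 then P.g0 else 1 / Real.sqrt (1 / P.g0 ^ 2 - k)) :
    S.cpl ⟨1, 0, 1 / 2⟩ 0 = 1 / 2 ∧ S.cpl ⟨1, 0, 1 / 2⟩ 1 = 1 / Real.sqrt 3 ∧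
      Step.InInterval 1 1 (S.cpl ⟨1, 0, 1 / 2⟩) := by
  have h0 : S.cpl ⟨1, 0, 1 / 2⟩ 0 = 1 / 2 := by rw [hcpl]; simp
  have h1 : S.cpl ⟨1, 0, 1 / 2⟩ 1 = 1 / Real.sqrt 3 := by rw [hcpl]; norm_num
  have h3 : (1 : ℝ) ≤ Real.sqrt 3 := Real.one_le_sqrt.mpr (by norm_num)
  refine ⟨h0, h1, fun k hk => ?_⟩
  interval_cases k
  · rw [h0]; norm_num
  · rw [h1]
    exact ⟨by positivity, (div_le_one (by positivity)).mpr h3⟩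

/-- **PROVER 1's BINDER `hrg` FAILS FOR THE OVERRUN TOY** (γ = 1): the table of (1, 0, 1∕2) reads (1∕2, 1∕√3) ⊂ ]0, 1], so under `hrg` it
would be a run Theorem 3 speaks of with K = 1 — and there is none (`runHyp_K_eq_zero`). [cite: Balaban1987RG1, (0.20) p.256 with Thm 3 p.264] -/
theorem not_hrg_of_toy (hβ : ∀ (k : ℕ) (p : Fin (k + 1) → ℝ), S.β k p = 1 / (p (Fin.last k)) ^ 2)
    (hcpl : ∀ (P : B12.RunParams) (k : ℕ), S.cpl P k = if k = 0 then P.g0 else 1 / Real.sqrt (1 / P.g0 ^ 2 - k))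
    (hγ : S.γ = 1) :
    ¬ ∀ P : B12.RunParams, Step.InInterval S.γ P.K (S.cpl P) → FlowStep.RGEqH P.K S.β (S.cpl P) := by
  intro h
  have hI : Step.InInterval S.γ 1 (S.cpl ⟨1, 0, 1 / 2⟩) := by
    rw [hγ]
    exact (run_one_of_toy hcpl).2.2
  have hP : RunHyp S ⟨1, 0, 1 / 2⟩ := ⟨h ⟨1, 0, 1 / 2⟩ hI, hI⟩
  exact one_ne_zero (runHyp_K_eq_zero hP hβ)

/-- **PROVER 2's HALTING NORMALISATION FAILS FOR THE OVERRUN TOY** (the hypothesis of `…LowerEnd.hrg_of_halts`): at (1, 0, 1∕2) the right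
side of (0.20) is 0 at k = 0, yet g₁ = 1∕√3 > 0 — the table runs on. [cite: Balaban1987RG1, (0.20) p.256] -/
theorem not_halts_of_toy (hβ : ∀ (k : ℕ) (p : Fin (k + 1) → ℝ), S.β k p = 1 / (p (Fin.last k)) ^ 2)
    (hcpl : ∀ (P : B12.RunParams) (k : ℕ), S.cpl P k = if k = 0 then P.g0 else 1 / Real.sqrt (1 / P.g0 ^ 2 - k)) :
    ¬ ∀ (P : B12.RunParams) (k : ℕ), k < P.K → (∀ i, i ≤ k → 0 < S.cpl P i) →
        1 / (S.cpl P k) ^ 2 - S.β k (prefixOf (S.cpl P) k) ≤ 0 → S.cpl P (k + 1) ≤ 0 := by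
  intro h
  obtain ⟨-, h1, hI⟩ := run_one_of_toy hcpl
  have hle := h ⟨1, 0, 1 / 2⟩ 0 Nat.one_pos (fun i hi => (hI i (hi.trans zero_le_one)).1) (rhs020_eq_zero hβ _ 0).le
  exact absurd hle (not_le.mpr (hI 1 le_rfl).1)

/-! ## §2 The overrun toy satisfies the as-printed interface -/

/-- **THE OVERRUN TOY**: L = 13, γ = 1; β_{k+1}(g₀, …, g_k) := 1∕g_k²; Π_{k+1} := (1∕g_k²)·Re Qᵀ, pol F := F(1)·Re Qᵀ, log Z ≡ 0, 𝐄_int = 𝐄 :=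
1∕g_k² (prover 1's toy kernel, `…Witness` §2 BY NAME); (1.18)-slot «|F(1)| ≦ E», δ₁ = E₀ = 1, C510 = MQ(1, 4); table `g₀` (k = 0),
`(1∕g₀² − k)^{−1∕2}` (k ≧ 1).  `StandingHypotheses ∧ Definitions ∧ Conclusions` hold: `d020` is vacuous (`rhs020_eq_zero`), every run-level
conclusion is vacuous (`no_step`), (5.10)'s schema holds for the toy kernel.  Defining equations exported. [folklore] -/
theorem overrunToy_exists : ∃ S : Setting,
    (∀ (k : ℕ) (p : Fin (k + 1) → ℝ), S.β k p = 1 / (p (Fin.last k)) ^ 2) ∧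
    (∀ (P : B12.RunParams) (k : ℕ), S.cpl P k = if k = 0 then P.g0 else 1 / Real.sqrt (1 / P.g0 ^ 2 - k)) ∧
    S.γ = 1 ∧ S.L = 13 ∧ StandingHypotheses S ∧ Definitions S ∧ Conclusions S := by
  -- `Setting` fields (anonymous constructor, order as in `…Witness.zeroToy_exists`): L, groupScope, ε₀, cpl, β, γ, M, κ, Cfg, one, logZ,
  -- Eint, Ebold, repr437, α₀, α₁, E₀, Mκ, pol, polIV, κ₀, indAss, ε₁, altCutoff266, logN2, δ₀, δ₁, C510, C544.
  refine ⟨⟨13, True, 1, fun P k => if k = 0 then P.g0 else 1 / Real.sqrt (1 / P.g0 ^ 2 - k),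
      fun k p => 1 / (p (Fin.last k)) ^ 2, 1, 1, 1, fun _ => Unit, fun _ => (), fun _ _ => 0,
      fun k p _ => 1 / (p (Fin.last k)) ^ 2, fun k p _ => 1 / (p (Fin.last k)) ^ 2, fun _ F E => |F ()| ≤ E, 1, 1, 1, fun _ => 1,
      fun _ F => fun μ ν x => F () * (wilsonQ ν μ x).re,
      fun k p => fun μ ν x => (1 / (p (Fin.last k)) ^ 2) * (wilsonQ ν μ x).re, 1, fun _ _ => True, 1, True,
      fun k p => 1 / (p (Fin.last k)) ^ 2, 1, 1, MQ 1 4, 1⟩,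
    fun _ _ => rfl, fun _ _ => rfl, rfl, rfl, ?_, ?_, ?_⟩
  · exact { hL := ⟨by decide, by norm_num⟩, hG := trivial, hκ₀ := by norm_num, hMκ := by norm_num, hγ := by norm_num,
            hε₀ := by norm_num, hε₁ := by norm_num, hα₀ := by norm_num, hα₁ := by norm_num, hκ := by norm_num,
            hM := by norm_num }
  · refine { d018 := ?_, d020 := ?_, d13 := ?_, d213 := ?_, d214 := ?_, d120 := ?_, d120split := ?_, d121 := ?_, d122 := ?_ }
    · intro P
      show (if (0 : ℕ) = 0 then P.g0 else 1 / Real.sqrt (1 / P.g0 ^ 2 - ((0 : ℕ) : ℝ))) = P.g0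
      rw [if_pos rfl]
    · intro P k _ _ hrhs
      exact (lt_irrefl (0 : ℝ) (by rwa [rhs020_eq_zero (fun _ _ => rfl)] at hrhs)).elim
    · intro j p U; simp
    · intro k p p' hp hp'
      funext U
      show 1 / (p (Fin.last k)) ^ 2 = 1 / (p' (Fin.last k)) ^ 2
      rw [hp, hp']
    · intro k p; rfl
    · intro j p; rfl
    · intro j p; funext μ ν x; simp
    · intro j p
      refine ⟨fun σ μ ν x => ?_, fun ε hε μ ν z => reflect_toyKernel (1 / (p (Fin.last j)) ^ 2) hε μ ν z, fun μ ν z => ?_⟩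
      · show 1 / (p (Fin.last j)) ^ 2 * (wilsonQ (σ ν) (σ μ) (x ∘ σ.symm)).re = 1 / (p (Fin.last j)) ^ 2 * (wilsonQ ν μ x).re
        rw [wilsonQ_perm]
      · show 1 / (p (Fin.last j)) ^ 2 * (wilsonQ ν μ z).re = 1 / (p (Fin.last j)) ^ 2 * (wilsonQ μ ν (-z)).re
        rw [wilsonQ_neg_transpose ν μ z]
    · intro j p _ μ ν hμν
      exact ⟨(fourier_toyKernel hμν (1 / (p (Fin.last j)) ^ 2)).symm, (secondMoment_toyKernel hμν (1 / (p (Fin.last j)) ^ 2)).symm⟩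
  · refine { c13 := fun _ _ _ _ => trivial, c118 := fun P hP j hj => (no_step hP hj fun _ _ => rfl).elim,
             c264 := fun P hP j hj => (no_step hP hj fun _ _ => rfl).elim, c510 := ?_,
             c537 := fun P hP j hj => (no_step hP hj fun _ _ => rfl).elim }
    refine ⟨by norm_num, fun j F E hF μ ν x => ?_⟩
    have hF' : |F ()| ≤ E := hF
    have hd := decay510_toyKernel (d := 4) (F ()) μ ν x
    show |F () * (wilsonQ ν μ x).re| ≤ MQ 1 4 * E * Real.exp (-1 * B12Sec2to5.l1 x)
    calc |F () * (wilsonQ ν μ x).re| ≤ |F ()| * MQ 1 4 * Real.exp (-1 * B12Sec2to5.l1 x) := hd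
      _ ≤ E * MQ 1 4 * Real.exp (-1 * B12Sec2to5.l1 x) :=
          mul_le_mul_of_nonneg_right (mul_le_mul_of_nonneg_right hF' (MQ_nonneg 1 4)) (Real.exp_pos _).le
      _ = MQ 1 4 * E * Real.exp (-1 * B12Sec2to5.l1 x) := by ring

/-! ## §3 Headlines: `hrg`, the box-wide (U) and B16 p. 355's sentence are NOT supplied by the interface + Theorem 2 -/

/-- **[I] AS PRINTED + THEOREM 2 AS PRINTED ARE CONSISTENT WITH THE FAILURE OF `hrg`, OF (U) ON EVERY BOX, AND OF THE HALTING CLAUSE.**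
A setting with `StandingHypotheses ∧ Definitions ∧ Conclusions` (hence `B12BetaAsPrinted S`) AND `Theorem2Statement S hL` in which: every run
Theorem 3 speaks of has K = 0; `FlowStep.BetaUpperH b′ γ S.β` fails for every b′ and every γ > 0 (the hypothesis of `…TunedUpper.hrg_of_betaUpperH`);
prover 2's halting normalisation (the hypothesis of `…LowerEnd.hrg_of_halts`) fails; and prover 1's binder `hrg` of `…Tuned` FAILS.  None of the
three is a consequence of the typed content of [I]+[II] plus [I]'s unproved Theorem 2: they are genuine extra letters on this carrier. [cite: Balaban1987RG1, Thm 2 (0.31) p.259, Thm 3 p.264, (0.20) p.256; Balaban1989LargeFieldII, Thm 1 p.355] -/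
theorem asPrinted_and_theorem2_consistent_with_not_hrg :
    ∃ S : Setting, ∃ hH : StandingHypotheses S, Definitions S ∧ Conclusions S ∧ B12BetaAsPrinted S ∧
      Theorem2Statement S (hL_of_standing hH) ∧
      (∀ P : B12.RunParams, RunHyp S P → P.K = 0) ∧
      (∀ (b' γ : ℝ), 0 < γ → ¬ BetaUpperH b' γ S.β) ∧
      (¬ ∀ (P : B12.RunParams) (k : ℕ), k < P.K → (∀ i, i ≤ k → 0 < S.cpl P i) →
          1 / (S.cpl P k) ^ 2 - S.β k (prefixOf (S.cpl P) k) ≤ 0 → S.cpl P (k + 1) ≤ 0) ∧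
      ¬ ∀ P : B12.RunParams, Step.InInterval S.γ P.K (S.cpl P) → FlowStep.RGEqH P.K S.β (S.cpl P) := by
  obtain ⟨S, hβ, hcpl, hγ, hL, hH, hD, hC⟩ := overrunToy_exists
  have hn := not_hrg_of_toy hβ hcpl hγ
  exact ⟨S, hH, hD, hC, fun _ _ => hC, theorem2Statement_of_toy hcpl hL, fun P hP => runHyp_K_eq_zero hP hβ,
    fun b' γ hγ' => not_betaUpperH hβ b' hγ', not_halts_of_toy hβ hcpl, hn⟩

/-- **`hrg` IS INDEPENDENT OF THE INTERFACE + THEOREM 2, AS TYPED**: neither `… → hrg` (the overrun toy) nor `… → ¬hrg` (prover 1's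
last-variable toy, `…TunedWitness.tunedHypotheses_nonvacuous`).  The binder of `…Tuned` is located correctly: print DEFINES g_{k+1} by (0.20)
(p. 256), the interface types only the forward-determination half `d020`, and no other typed field closes the gap (DELTA-I D-4). [cite: Balaban1987RG1, (0.20) p.256 with Thm 3 p.264 and Thm 2 p.259] -/
theorem hrg_independent_of_asPrinted_and_theorem2 :
    (¬ ∀ (S : Setting) (hH : StandingHypotheses S), Definitions S → Conclusions S →
        Theorem2Statement S (hL_of_standing hH) →
        ∀ P : B12.RunParams, Step.InInterval S.γ P.K (S.cpl P) → FlowStep.RGEqH P.K S.β (S.cpl P)) ∧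
    (¬ ∀ (S : Setting) (hH : StandingHypotheses S), Definitions S → Conclusions S →
        Theorem2Statement S (hL_of_standing hH) →
        ¬ ∀ P : B12.RunParams, Step.InInterval S.γ P.K (S.cpl P) → FlowStep.RGEqH P.K S.β (S.cpl P)) := by
  constructor
  · intro h
    obtain ⟨S, hH, hD, hC, -, hT, -, -, -, hn⟩ := asPrinted_and_theorem2_consistent_with_not_hrg
    exact hn (h S hH hD hC hT)
  · intro h
    obtain ⟨S, hH, hD, hC, -, hrg, hT, -⟩ := tunedHypotheses_nonvacuous
    exact h S hH hD hC hT hrg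

/-- **O-2 MADE TWO-SIDED: THE BOX-WIDE (U) IS INDEPENDENT OF THE INTERFACE + THEOREM 2, AS TYPED.**  The interface supplies (U) on run
prefixes of Theorem-3 runs (`B12AsPrintedRowD4Junction.abs_beta_prefix_le_betaPrime510`); on the boxes it decides nothing: prover 1's AF toy
(`…Witness.asPrinted_consistent_with_theorem2_and_AF`) HAS `BetaUpperH b S.γ S.β`, the overrun toy has `BetaUpperH b′ γ S.β` for no b′, γ > 0. [cite: Balaban1987RG1, p.264 («uniformly bounded on this interval») with Thm 3 p.264] -/
theorem boxUpperH_independent_of_asPrinted_and_theorem2 :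
    (¬ ∀ (S : Setting) (hH : StandingHypotheses S), Definitions S → Conclusions S →
        Theorem2Statement S (hL_of_standing hH) → ∃ b' γ : ℝ, 0 < γ ∧ BetaUpperH b' γ S.β) ∧
    (¬ ∀ (S : Setting) (hH : StandingHypotheses S), Definitions S → Conclusions S →
        Theorem2Statement S (hL_of_standing hH) → ∀ b' γ : ℝ, 0 < γ → ¬ BetaUpperH b' γ S.β) := by
  constructor
  · intro h
    obtain ⟨S, hH, hD, hC, -, hT, -, hU, -, -⟩ := asPrinted_and_theorem2_consistent_with_not_hrg
    obtain ⟨b', γ, hγ, hup⟩ := h S hH hD hC hT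
    exact hU b' γ hγ hup
  · intro h
    obtain ⟨S, hH, hD, hC, -, ⟨b, -, -, -, hup, -⟩, -, hT⟩ := asPrinted_consistent_with_theorem2_and_AF
    exact h S hH hD hC hT b S.γ hH.hγ hup

/-- **AMONG THE β SUB-CELL'S THREE BOX LETTERS IT IS (U) THAT CARRIES `hrg`.**  The overrun toy has `StandingHypotheses ∧ Definitions ∧
Conclusions ∧ Theorem2Statement`, the SIGN ∕ AF letter `BetaLowerH 1 S.γ S.β` and the joint-continuity letter `BetaContH S.γ S.β`, while (U)
fails on every box and `hrg` fails: (L) + (C) + Theorem 2 + the interface do not give «the run obeys (0.20) inside the interval»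
(`…TunedUpper.hrg_of_betaUpperH` uses (U) alone). [cite: Balaban1987RG1, (0.20) p.256 with p.264 («uniformly bounded») and Thm 2 p.259] -/
theorem letters_of_overrunToy :
    ∃ S : Setting, ∃ hH : StandingHypotheses S, Definitions S ∧ Conclusions S ∧ Theorem2Statement S (hL_of_standing hH) ∧
      BetaLowerH 1 S.γ S.β ∧ BetaContH S.γ S.β ∧ (∀ (b' γ : ℝ), 0 < γ → ¬ BetaUpperH b' γ S.β) ∧
      ¬ ∀ P : B12.RunParams, Step.InInterval S.γ P.K (S.cpl P) → FlowStep.RGEqH P.K S.β (S.cpl P) := by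
  obtain ⟨S, hβ, hcpl, hγ, hL, hH, hD, hC⟩ := overrunToy_exists
  refine ⟨S, hH, hD, hC, theorem2Statement_of_toy hcpl hL, ?_, betaContH_of_toy hβ S.γ,
    fun b' γ hγ' => not_betaUpperH hβ b' hγ', not_hrg_of_toy hβ hcpl hγ⟩
  rw [hγ]
  exact betaLowerH_of_toy hβ

/-- **B16 p. 355's SENTENCE IS NOT A CONSEQUENCE OF THE TYPED INTERFACE + THEOREM 2.**  *"Theorem 2 of [I] allows us to remove the
assumption on the effective coupling constants"* needs Theorem 2's tuned runs to be runs Theorem 3 speaks of (`…Tuned.runHyp_of_theorem2Statement`,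
under `hrg`); without `hrg`: a setting with all of the above and NO Theorem-3 run at K = 1 (any m, g₀) — `…Tuned` ∕ `…TunedUpper` ∕ `…Lower`'s
tuned-run theorems genuinely need the binder, or (U) ∕ the halting clause. [cite: Balaban1989LargeFieldII, Thm 1 p.355; Balaban1987RG1, Thm 2 p.259, Thm 3 p.264] -/
theorem no_thm3_run_at_K_one :
    ∃ S : Setting, ∃ hH : StandingHypotheses S, Definitions S ∧ Conclusions S ∧ Theorem2Statement S (hL_of_standing hH) ∧
      ∀ (m : ℕ) (g₀ : ℝ), ¬ RunHyp S ⟨1, m, g₀⟩ := by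
  obtain ⟨S, hH, hD, hC, -, hT, hK0, -, -, -⟩ := asPrinted_and_theorem2_consistent_with_not_hrg
  exact ⟨S, hH, hD, hC, hT, fun m g₀ hP => one_ne_zero (hK0 _ hP)⟩

/-- **… AND THE EXISTENCE OF A THEOREM-3 RUN WITH A STEP IS INDEPENDENT of the interface + Theorem 2, as typed**: prover 1's AF toy
(`…Witness.asPrinted_consistent_with_theorem2_and_AF`) has one with K ≧ 1 (`c118 ∕ c264 ∕ c537` exercised), the overrun toy has none — the typed
content of [I]+[II] plus Theorem 2 says nothing about the runs «defined inductively by (0.17)–(0.20)» beyond K = 0 until `hrg` is supplied. [cite: Balaban1987RG1, Thm 3 p.264 with (0.20) p.256; Balaban1989LargeFieldII, Thm 1 p.355] -/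
theorem thm3Runs_independent_of_asPrinted_and_theorem2 :
    (¬ ∀ (S : Setting) (hH : StandingHypotheses S), Definitions S → Conclusions S →
        Theorem2Statement S (hL_of_standing hH) → ∃ P : B12.RunParams, RunHyp S P ∧ 1 ≤ P.K) ∧
    (¬ ∀ (S : Setting) (hH : StandingHypotheses S), Definitions S → Conclusions S →
        Theorem2Statement S (hL_of_standing hH) → ∀ P : B12.RunParams, RunHyp S P → P.K = 0) := by
  constructor
  · intro h
    obtain ⟨S, hH, hD, hC, -, hT, hK0, -, -, -⟩ := asPrinted_and_theorem2_consistent_with_not_hrg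
    obtain ⟨P, hP, hK⟩ := h S hH hD hC hT
    have h0 := hK0 P hP
    omega
  · intro h
    obtain ⟨S, hH, hD, hC, -, -, ⟨P, hP, hK⟩, hT⟩ := asPrinted_consistent_with_theorem2_and_AF
    have h0 := h S hH hD hC hT P hP
    omega

end Summit.QuantumFields.BalabanUV.Beta.B12AsPrintedRowD4JunctionHrgWitness

end
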